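import Mathlib
import Summits.NavierStokesRegularity.FluidComputer.TorusHighBandCeilingClassical
import Literature.Analysis.FunctionSpaces.TorusClassicalNSGluing
import Literature.Analysis.FluidPDE.PeriodicBoundedMildTorus
import HarnessLib

/-!
# The Bernstein value of the low-band strain and the energy-only high-band ceiling for periodic Navier–Stokes

HONEST FRAMING (cell `ns-blowup`, seat `ns-blowup-circuit` g6, human ruling D-0035): nothing here is a
claim about Navier–Stokes blow-up. WHAT THIS IS NOT: not a regularity criterion (the bound below GROWS
with the band edge `M`), not blow-up evidence. Part 5 of the `TorusHighBand*` files (p445097 /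
p445831 / p446381 / p446939): the low-band ℓ¹-strain `K_M(v) = Torus.truncDerivBound M v` is at most
its BERNSTEIN value `2π · #d · M · √#{|k|² ≤ M²} · ‖P_M v‖₂` (`truncDerivBound_le_bernstein`; Cauchy–
Schwarz on the ball; `#{|k|² ≤ M²} ≤ (2M+1)^d`, `Torus.card_freqBall_le`), so the hypothesis
`K_M‖u‖₂ + ‖f‖₂ ≤ G` of `highBand_ceiling` is met with `G = 2π·#d·M·√#ball·E₂ + F` from an a.e.
energy bound `∫‖u(s)‖² ≤ E₂` and force bound `‖f(s)‖₂ ≤ F` ALONE: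

* `highBand_ceiling_of_energy_bound` — `‖Q_M u(t)‖₂ ≤ max(‖Q_M u(0)‖₂, (2π·#d·M·√#ball·E₂ + F)/(4π²ν(M²+1)))`
  (Leray–Hopf with continuous band energy), and `…_classical` for classical solutions.

READING (memo `CIRCUIT-OBSTRUCTIONS.md` §A.5/§G/§L.6/§M): this is Palasek's `α = 5/2` sentence for
Navier–Stokes itself — energy conservation plus the flux ceiling bound the band `|k| > M` only by
`≈ M^{1+d/2}E₂/(νM²) = M^{d/2-1}E₂/ν`, which in `d = 3` grows like `√M`: the gap between this ceiling
and regularity is exactly the COHERENCE question (how close to Bernstein saturation the low band runs),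
the typed residue of the circuit line. No definitions.
-/

noncomputable section

open MeasureTheory Set Filter UnitAddTorus Function
open scoped ENNReal NNReal InnerProductSpace RealInnerProductSpace Topology

namespace Summit.NavierStokesRegularity.FluidComputer.TorusHighBandFluxCeiling

open Literature.Analysis Literature.Analysis.FunctionSpaces Literature.Analysis.FluidPDE

variable {d : Type*} [Fintype d] [DecidableEq d]

section Bernstein

/-- `Σ_{k∈s} a k ≤ √#s · √(Σ_{k∈s} (a k)²)` (Cauchy–Schwarz against the constant `1`). [folklore] -/
private theorem sum_le_sqrt_card_mul_sqrt_sum_sq {ι : Type*} (s : Finset ι) (a : ι → ℝ) :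
    ∑ i ∈ s, a i ≤ Real.sqrt s.card * Real.sqrt (∑ i ∈ s, a i ^ 2) := by
  have h := Real.abs_le_sqrt (Finset.sum_mul_sq_le_sq_mul_sq s (fun _ => (1 : ℝ)) a)
  simp only [one_mul, one_pow, Finset.sum_const, nsmul_eq_mul, mul_one] at h
  rw [Real.sqrt_mul (Nat.cast_nonneg _)] at h
  exact (le_abs_self _).trans h

/-- **Bernstein value of the low-band ℓ¹-strain**: for `v ∈ L²(T^d)`,
`K_M(v) ≤ 2π · #d · M · √#{|k|² ≤ M²} · (∫‖P_M v‖²)^{1/2}` (`|kᵢ| ≤ |k| ≤ M` on the ball,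
Cauchy–Schwarz, Parseval for the truncation). Equality needs all `|û(k)|`, `|k| ≤ M`, of equal size —
a maximally concentrated low band. [folklore] -/
theorem truncDerivBound_le_bernstein {v : UnitAddTorus d → EuclideanSpace ℝ d} (hv : MemLp v 2 volume)
    (M : ℕ) :
    FluidPDE.Torus.truncDerivBound M v ≤ 2 * Real.pi * Fintype.card d * M *
      Real.sqrt ((Torus.freqBall (d := d) M).card) *
        Real.sqrt (∫ x, ‖Torus.fourierTruncate M v x‖ ^ 2) := by
  classical
  set a : (d → ℤ) → ℝ := fun k => ‖mFourierCoeff (EuclideanSpace.complexify ∘ v) k‖ with ha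
  have hkM : ∀ k ∈ Torus.freqBall (d := d) M, ∀ i : d, |(k i : ℝ)| ≤ M := by
    intro k hk i
    have h1 := Torus.abs_apply_le_sqrt_freqNormSq k i
    have h2 : Real.sqrt (Torus.freqNormSq k) ≤ M := by
      rw [← Real.sqrt_sq (Nat.cast_nonneg M)]
      exact Real.sqrt_le_sqrt (Torus.mem_freqBall.1 hk)
    exact h1.trans h2
  -- each coordinate sum is at most `2πM Σ a`
  have hcoord : ∀ i : d, ∑ k ∈ Torus.freqBall M, 2 * Real.pi * |(k i : ℝ)| * a k ≤
      2 * Real.pi * M * ∑ k ∈ Torus.freqBall M, a k := by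
    intro i
    rw [Finset.mul_sum]
    refine Finset.sum_le_sum fun k hk => ?_
    have hak : 0 ≤ a k := norm_nonneg _
    have := hkM k hk i
    gcongr
  have hsum : FluidPDE.Torus.truncDerivBound M v ≤
      Fintype.card d * (2 * Real.pi * M * ∑ k ∈ Torus.freqBall M, a k) := by
    unfold FluidPDE.Torus.truncDerivBound
    calc ∑ i : d, ∑ k ∈ Torus.freqBall M, 2 * Real.pi * |(k i : ℝ)| *
            ‖mFourierCoeff (EuclideanSpace.complexify ∘ v) k‖
        ≤ ∑ _i : d, 2 * Real.pi * M * ∑ k ∈ Torus.freqBall M, a k := Finset.sum_le_sum fun i _ => hcoord i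
      _ = Fintype.card d * (2 * Real.pi * M * ∑ k ∈ Torus.freqBall M, a k) := by
          rw [Finset.sum_const, Finset.card_univ, nsmul_eq_mul]
  have hCS := sum_le_sqrt_card_mul_sqrt_sum_sq (Torus.freqBall (d := d) M) a
  have hpars : ∑ k ∈ Torus.freqBall M, a k ^ 2 = ∫ x, ‖Torus.fourierTruncate M v x‖ ^ 2 :=
    (Torus.integral_norm_sq_fourierTruncate (hv.integrable one_le_two) M).symm
  rw [hpars] at hCS
  have hpos : 0 ≤ 2 * Real.pi * M := by positivity
  calc FluidPDE.Torus.truncDerivBound M v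
      ≤ Fintype.card d * (2 * Real.pi * M * ∑ k ∈ Torus.freqBall M, a k) := hsum
    _ ≤ Fintype.card d * (2 * Real.pi * M * (Real.sqrt ((Torus.freqBall (d := d) M).card) *
          Real.sqrt (∫ x, ‖Torus.fourierTruncate M v x‖ ^ 2))) := by
        gcongr
    _ = _ := by ring

/-- The Bernstein form of the source bound: for `v ∈ L²`,
`K_M(v)·‖v‖₂ ≤ 2π·#d·M·√#ball · ∫‖v‖²` (`‖P_M v‖₂ ≤ ‖v‖₂`). [folklore] -/
theorem truncDerivBound_mul_norm_le {v : UnitAddTorus d → EuclideanSpace ℝ d} (hv : MemLp v 2 volume)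
    (M : ℕ) :
    FluidPDE.Torus.truncDerivBound M v * Real.sqrt (∫ x, ‖v x‖ ^ 2) ≤
      2 * Real.pi * Fintype.card d * M * Real.sqrt ((Torus.freqBall (d := d) M).card) *
        ∫ x, ‖v x‖ ^ 2 := by
  have h1 := truncDerivBound_le_bernstein hv M
  have hB : Real.sqrt (∫ x, ‖Torus.fourierTruncate M v x‖ ^ 2) ≤ Real.sqrt (∫ x, ‖v x‖ ^ 2) :=
    Real.sqrt_le_sqrt (Torus.integral_norm_sq_fourierTruncate_le hv M)
  have hE : 0 ≤ ∫ x, ‖v x‖ ^ 2 := integral_nonneg fun x => by positivity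
  have hK : 0 ≤ 2 * Real.pi * Fintype.card d * M * Real.sqrt ((Torus.freqBall (d := d) M).card) := by
    positivity
  calc FluidPDE.Torus.truncDerivBound M v * Real.sqrt (∫ x, ‖v x‖ ^ 2)
      ≤ (2 * Real.pi * Fintype.card d * M * Real.sqrt ((Torus.freqBall (d := d) M).card) *
          Real.sqrt (∫ x, ‖v x‖ ^ 2)) * Real.sqrt (∫ x, ‖v x‖ ^ 2) :=
        mul_le_mul_of_nonneg_right (h1.trans (mul_le_mul_of_nonneg_left hB hK)) (Real.sqrt_nonneg _)
    _ = _ := by rw [mul_assoc, Real.mul_self_sqrt hE]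

end Bernstein

section EnergyOnly

variable {T ν : ℝ} {f u : ℝ → UnitAddTorus d → EuclideanSpace ℝ d} {p : ℝ → UnitAddTorus d → ℝ}

/-- **ENERGY-ONLY HIGH-BAND CEILING (Leray–Hopf, continuous band energy).** If `∫‖u(s)‖² ≤ E₂` and
`‖f(s)‖₂ ≤ F` for a.e. `s ∈ (0,T)`, then for every band edge `M` and `t ∈ [0,T]`
`‖Q_M u(t)‖₂ ≤ max(‖Q_M u(0)‖₂, (2π·#d·M·√#{|k|²≤M²}·E₂ + F) / (4π²ν(M²+1)))` — Palasek's `α = 5/2`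
sentence for Navier–Stokes itself: in `d = 3` the right side grows like `√M`. [folklore] -/
theorem highBand_ceiling_of_energy_bound (hu : FluidPDE.Torus.IsLerayHopfOn T ν f (u 0) u) (hT : 0 < T)
    (hfm : AEStronglyMeasurable (Torus.stLift f) (volume.restrict (Ioo 0 T ×ˢ univ)))
    (hf : FluidPDE.Torus.MemLqLp 1 2 f (Ioo 0 T)) (hν : 0 < ν) (M : ℕ) {E₂ F : ℝ}
    (hE : ∀ᵐ s ∂(volume.restrict (Ioo 0 T)), ∫ x, ‖u s x‖ ^ 2 ≤ E₂)
    (hF : ∀ᵐ s ∂(volume.restrict (Ioo 0 T)), Real.sqrt (∫ x, ‖f s x‖ ^ 2) ≤ F)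
    (hcont : ContinuousOn (fun s => Torus.kineticEnergy (u s - Torus.fourierTruncate M (u s))) (Icc 0 T)) :
    ∀ t ∈ Icc 0 T, Real.sqrt (2 * Torus.kineticEnergy (u t - Torus.fourierTruncate M (u t))) ≤
      max (Real.sqrt (2 * Torus.kineticEnergy (u 0 - Torus.fourierTruncate M (u 0))))
        ((2 * Real.pi * Fintype.card d * M * Real.sqrt ((Torus.freqBall (d := d) M).card) * E₂ + F) /
          (4 * Real.pi ^ 2 * ν * ((M : ℝ) ^ 2 + 1))) := by
  refine highBand_ceiling hu hT hfm hf hν M ?_ hcont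
  filter_upwards [hE, hF, ae_restrict_mem measurableSet_Ioo] with s hEs hFs hs
  have hus : MemLp (u s) 2 volume := hu.memLp s ⟨hs.1.le, hs.2.le⟩
  have h1 := truncDerivBound_mul_norm_le hus M
  have hK : 0 ≤ 2 * Real.pi * Fintype.card d * M * Real.sqrt ((Torus.freqBall (d := d) M).card) := by
    positivity
  nlinarith [h1, mul_le_mul_of_nonneg_left hEs hK, hFs]

/-- **ENERGY-ONLY HIGH-BAND CEILING for classical solutions** of the periodic Navier–Stokes equations on
`[0,T] × T^d` (`T > 0`, `ν > 0`): with a.e. bounds `∫‖u(s)‖² ≤ E₂`, `‖f(s)‖₂ ≤ F` on `(0,T)`,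
`‖Q_M u(t)‖₂ ≤ max(‖Q_M u(0)‖₂, (2π·#d·M·√#{|k|²≤M²}·E₂ + F)/(4π²ν(M²+1)))` for all `t ∈ [0,T]`
and every `M`. [folklore] -/
theorem highBand_ceiling_of_energy_bound_classical
    (h : Torus.IsClassicalNSSolutionOn (Icc 0 T) ν f u p) (hT : 0 < T) (hν : 0 < ν) (M : ℕ)
    {E₂ F : ℝ} (hE : ∀ᵐ s ∂(volume.restrict (Ioo 0 T)), ∫ x, ‖u s x‖ ^ 2 ≤ E₂)
    (hF : ∀ᵐ s ∂(volume.restrict (Ioo 0 T)), Real.sqrt (∫ x, ‖f s x‖ ^ 2) ≤ F) :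
    ∀ t ∈ Icc 0 T, Real.sqrt (2 * Torus.kineticEnergy (u t - Torus.fourierTruncate M (u t))) ≤
      max (Real.sqrt (2 * Torus.kineticEnergy (u 0 - Torus.fourierTruncate M (u 0))))
        ((2 * Real.pi * Fintype.card d * M * Real.sqrt ((Torus.freqBall (d := d) M).card) * E₂ + F) /
          (4 * Real.pi ^ 2 * ν * ((M : ℝ) ^ 2 + 1))) := by
  have hLH := h.isLerayHopfOn_of_convex (convex_Icc 0 T) hT subset_rfl
  obtain ⟨hfm, hf⟩ := force_bookkeeping_of_smooth
    (isSmoothSpaceTimeOn_force_of_classical h (uniqueDiffOn_Icc hT))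
  exact highBand_ceiling_of_energy_bound hLH hT hfm hf hν M hE hF
    (continuousOn_highBand_energy h.smooth_velocity (convex_Icc 0 T) M)

end EnergyOnly

section Window

variable {T ν : ℝ} {f u : ℝ → UnitAddTorus d → EuclideanSpace ℝ d} {p : ℝ → UnitAddTorus d → ℝ}

/-- **WINDOWED CEILING for classical solutions**: the high band at time `t` is controlled by its size
at ANY earlier time `t₁` and the low-band strain IN BETWEEN. For a classical solution on `[0,T] × T^d`,
`ν > 0`, a window `0 ≤ t₁ < t₂ ≤ T` and a level `G` with `K_M(u(s))‖u(s)‖₂ + ‖f(s)‖₂ ≤ G` for all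
`s ∈ (t₁,t₂)`: `‖Q_M u(t)‖₂ ≤ max(‖Q_M u(t₁)‖₂, G/(4π²ν(M²+1)))` for `t ∈ [t₁,t₂]` (time translation
`Torus.IsClassicalNSSolutionOn.comp_add_const` + restriction `.mono` + `highBand_ceiling_classical`).
Reading: the band `|k| > M` forgets strain episodes that ended before `t₁`. [folklore] -/
theorem highBand_ceiling_classical_window (h : Torus.IsClassicalNSSolutionOn (Icc 0 T) ν f u p)
    (hν : 0 < ν) (M : ℕ) {t₁ t₂ G : ℝ} (h0 : 0 ≤ t₁) (h12 : t₁ < t₂) (h2T : t₂ ≤ T)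
    (hG : ∀ s ∈ Ioo t₁ t₂, FluidPDE.Torus.truncDerivBound M (u s) * Real.sqrt (∫ x, ‖u s x‖ ^ 2) +
        Real.sqrt (∫ x, ‖f s x‖ ^ 2) ≤ G) :
    ∀ t ∈ Icc t₁ t₂, Real.sqrt (2 * Torus.kineticEnergy (u t - Torus.fourierTruncate M (u t))) ≤
      max (Real.sqrt (2 * Torus.kineticEnergy (u t₁ - Torus.fourierTruncate M (u t₁))))
        (G / (4 * Real.pi ^ 2 * ν * ((M : ℝ) ^ 2 + 1))) := by
  intro t ht
  have hT' : 0 < t₂ - t₁ := sub_pos.2 h12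
  -- restrict to the window and translate it to `[0, t₂ - t₁]`
  have h1 : Torus.IsClassicalNSSolutionOn (Icc t₁ t₂) ν f u p :=
    h.mono (Icc_subset_Icc h0 h2T) (uniqueDiffOn_Icc h12)
  have h2 := h1.comp_add_const t₁
  have hsub : Icc 0 (t₂ - t₁) ⊆ (· + t₁) ⁻¹' Icc t₁ t₂ := by
    intro s hs
    simp only [mem_preimage, mem_Icc] at hs ⊢
    constructor <;> linarith [hs.1, hs.2]
  have h3 : Torus.IsClassicalNSSolutionOn (Icc 0 (t₂ - t₁)) ν (fun s => f (s + t₁))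
      (fun s => u (s + t₁)) (fun s => p (s + t₁)) := h2.mono hsub (uniqueDiffOn_Icc hT')
  have hG' : ∀ᵐ s ∂(volume.restrict (Ioo 0 (t₂ - t₁))),
      FluidPDE.Torus.truncDerivBound M (u (s + t₁)) * Real.sqrt (∫ x, ‖u (s + t₁) x‖ ^ 2) +
        Real.sqrt (∫ x, ‖f (s + t₁) x‖ ^ 2) ≤ G := by
    filter_upwards [ae_restrict_mem measurableSet_Ioo] with s hs
    exact hG (s + t₁) ⟨by linarith [hs.1], by linarith [hs.2]⟩
  have hc := highBand_ceiling_classical h3 hT' hν M hG' (t - t₁) ⟨by linarith [ht.1], by linarith [ht.2]⟩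
  simp only [zero_add, sub_add_cancel] at hc
  exact hc

end Window

end Summit.NavierStokesRegularity.FluidComputer.TorusHighBandFluxCeiling
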